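import Summits.HubbardSuperconductivity.HubbardLadder.NeelPolyCert
import HarnessLib

/-!
# A reflective checker for two-variable cosine polynomials (HubbardLadder R2, H₀ line; support for the Σ-kernel rows)

HONEST FRAMING: ladder R1–R4 with certified numbers; no claim on H/H₀.  Pure trigonometric-polynomial bookkeeping,
[folklore]; no physics.  Extends the one-variable checker `NeelPolyCert` (`PolyCert.peval`, `padd`, `pmul`, `pscale`) used by
the window-majorant Néel-sign theorems (`NeelSign*.lean`, `NeelWindowMajorant`):

* two-variable dense rational polynomials in the power basis of `(x, y) = (cos q₀, cos q₁)`: `peval2`, `padd2`, `pscale2`,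
  `pmulC`, `pmul2`, `outer` with their evaluation homomorphism lemmas `peval2_*`;
* Chebyshev tables by the recurrence `T_{n+2} = 2X T_{n+1} - T_n` (`chebPair`, `chebT`, `peval_chebT : T_n(cos x) = cos(n x)`);
* the change of basis from a COSINE TABLE `W[i][j] ↔ Σ W[i][j] cos(i q₀) cos(j q₁)` to the power basis (`ofCosTable`,
  `peval2_ofCosTable`), the structural table sums `rowSum` / `tableSum`, their `Finset.range` forms
  (`sum_range_table_getD`), and the identification of the tree's dictionary kernel `klsKernel L (windowDict L (range N ×ˢ range M) (tableFun W)) b t`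
  (Literature `HeisenbergOrderNeelWindowDictionary.klsKernel_windowDict`) with the table's cosine series (`klsKernel_table`);
* a coefficientwise equality test `equiv2` (trailing zeros allowed) with soundness for evaluation (`peval2_eq_of_equiv2`) and
  for table lookup (`tableFun_eq_of_equiv2`), plus `tableFun_padd2` / `tableFun_pscale2`.

With these, a trigonometric identity between a cosine table and a polynomial expression in `(cos q₀, cos q₁)` is DECIDED by
the kernel on rational coefficient arrays (`decide`), instead of being re-proved by `ring` per instance.  Consumer:
`NeelSigmaKernel.lean` (Σ-kernel dictionary-infrared rows).  Imports: `NeelPolyCert` only (a Literature-only closure; the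
Chebyshev recurrence and character orthogonality are re-derived here from `Real.cos_add_cos` and the Literature torus characters
rather than imported from the D39 device file `NeelWindowMajorant`).  Pen: lineage B (pub-hubbard r2-eng-2 g5).
[folklore: Chebyshev polynomials, character orthogonality]
-/

namespace Summit.HubbardSuperconductivity.HubbardLadder.PolyCert

open Finset Literature.MathematicalPhysics.QuantumLattice Literature.Probability.LatticeModels
open Summit.HubbardSuperconductivity.HubbardLadder

/-! ### Two-variable dense rational polynomials `P(x,y) = Σᵢ pᵢ(y) xⁱ` -/

/-- Evaluation `[p₀, p₁, …] ↦ Σᵢ peval pᵢ y · xⁱ` (Horner in `x`). [folklore] -/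
def peval2 : List (List ℚ) → ℝ → ℝ → ℝ
  | [], _, _ => 0
  | p :: ps, x, y => peval p y + x * peval2 ps x y

/-- Auxiliary lemma `peval2_nil`. -/
@[simp] theorem peval2_nil (x y : ℝ) : peval2 [] x y = 0 := rfl

/-- Auxiliary lemma `peval2_cons`. -/
@[simp] theorem peval2_cons (p : List ℚ) (ps : List (List ℚ)) (x y : ℝ) :
    peval2 (p :: ps) x y = peval p y + x * peval2 ps x y := rfl

/-- Coefficientwise sum. [folklore] -/
def padd2 : List (List ℚ) → List (List ℚ) → List (List ℚ)
  | [], Q => Q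
  | P, [] => P
  | p :: ps, q :: qs => padd p q :: padd2 ps qs

/-- Auxiliary lemma `peval2_padd2`. -/
theorem peval2_padd2 (P Q : List (List ℚ)) (x y : ℝ) :
    peval2 (padd2 P Q) x y = peval2 P x y + peval2 Q x y := by
  induction P generalizing Q with
  | nil => simp [padd2]
  | cons p ps ih =>
    cases Q with
    | nil => simp [padd2]
    | cons q qs => simp [padd2, peval_padd, ih]; ring

/-- Rational scalar multiple. [folklore] -/
def pscale2 (a : ℚ) : List (List ℚ) → List (List ℚ)
  | [] => []
  | p :: ps => pscale a p :: pscale2 a ps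

/-- Auxiliary lemma `peval2_pscale2`. -/
theorem peval2_pscale2 (a : ℚ) (P : List (List ℚ)) (x y : ℝ) :
    peval2 (pscale2 a P) x y = (a : ℝ) * peval2 P x y := by
  induction P with
  | nil => simp [pscale2]
  | cons p ps ih => simp [pscale2, peval_pscale, ih]; ring

/-- Multiply every coefficient polynomial by the one-variable polynomial `a(y)`. [folklore] -/
def pmulC (a : List ℚ) : List (List ℚ) → List (List ℚ)
  | [] => []
  | p :: ps => pmul a p :: pmulC a ps

/-- Auxiliary lemma `peval2_pmulC`. -/
theorem peval2_pmulC (a : List ℚ) (P : List (List ℚ)) (x y : ℝ) :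
    peval2 (pmulC a P) x y = peval a y * peval2 P x y := by
  induction P with
  | nil => simp [pmulC]
  | cons p ps ih => simp [pmulC, peval_pmul, ih]; ring

/-- Product. [folklore] -/
def pmul2 : List (List ℚ) → List (List ℚ) → List (List ℚ)
  | [], _ => []
  | p :: ps, Q => padd2 (pmulC p Q) ([] :: pmul2 ps Q)

/-- Auxiliary lemma `peval2_pmul2`. -/
theorem peval2_pmul2 (P Q : List (List ℚ)) (x y : ℝ) :
    peval2 (pmul2 P Q) x y = peval2 P x y * peval2 Q x y := by
  induction P with
  | nil => simp [pmul2]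
  | cons p ps ih => simp [pmul2, peval2_padd2, peval2_pmulC, ih]; ring

/-- Outer product `p(x) · q(y)`. [folklore] -/
def outer : List ℚ → List ℚ → List (List ℚ)
  | [], _ => []
  | c :: cs, q => pscale c q :: outer cs q

/-- Auxiliary lemma `peval2_outer`. -/
theorem peval2_outer (p q : List ℚ) (x y : ℝ) :
    peval2 (outer p q) x y = peval p x * peval q y := by
  induction p with
  | nil => simp [outer]
  | cons c cs ih => simp [outer, peval_pscale, ih]; ring

/-- All coefficients zero (one variable). [folklore] -/
def isZero1 : List ℚ → Bool
  | [] => true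
  | c :: cs => decide (c = 0) && isZero1 cs

/-- Auxiliary lemma `peval_eq_zero_of_isZero1`. -/
theorem peval_eq_zero_of_isZero1 {p : List ℚ} (h : isZero1 p = true) (x : ℝ) : peval p x = 0 := by
  induction p with
  | nil => rfl
  | cons c cs ih =>
    simp only [isZero1, Bool.and_eq_true, decide_eq_true_eq] at h
    simp [h.1, ih h.2]

/-- All coefficients zero (two variables). [folklore] -/
def isZero2 : List (List ℚ) → Bool
  | [] => true
  | p :: ps => isZero1 p && isZero2 ps

/-- Auxiliary lemma `peval2_eq_zero_of_isZero2`. -/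
theorem peval2_eq_zero_of_isZero2 {P : List (List ℚ)} (h : isZero2 P = true) (x y : ℝ) :
    peval2 P x y = 0 := by
  induction P with
  | nil => rfl
  | cons p ps ih =>
    simp only [isZero2, Bool.and_eq_true] at h
    simp [peval_eq_zero_of_isZero1 h.1, ih h.2]

/-- Equality of two-variable polynomials as functions, decided on coefficients (trailing zeros allowed).
[folklore] -/
def equiv2 (P Q : List (List ℚ)) : Bool := isZero2 (padd2 P (pscale2 (-1) Q))

/-- **Soundness of the coefficient test**: `equiv2 P Q` implies `P = Q` as real functions. [folklore] -/
theorem peval2_eq_of_equiv2 {P Q : List (List ℚ)} (h : equiv2 P Q = true) (x y : ℝ) :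
    peval2 P x y = peval2 Q x y := by
  have h0 := peval2_eq_zero_of_isZero2 h x y
  rw [peval2_padd2, peval2_pscale2] at h0
  push_cast at h0
  linarith

/-! ### Chebyshev tables -/

/-- Chebyshev recurrence `cos((n+2)x) = 2 cos x cos((n+1)x) - cos(nx)` (from `Real.cos_add_cos`). [folklore] -/
private theorem cos_add_two_mul_rec (n : ℕ) (x : ℝ) :
    Real.cos (((n + 2 : ℕ) : ℝ) * x) = 2 * Real.cos x * Real.cos (((n + 1 : ℕ) : ℝ) * x) - Real.cos ((n : ℝ) * x) := by
  have h := Real.cos_add_cos (((n + 2 : ℕ) : ℝ) * x) ((n : ℝ) * x)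
  have e1 : ((((n + 2 : ℕ) : ℝ) * x) + (n : ℝ) * x) / 2 = ((n + 1 : ℕ) : ℝ) * x := by push_cast; ring
  have e2 : ((((n + 2 : ℕ) : ℝ) * x) - (n : ℝ) * x) / 2 = x := by push_cast; ring
  rw [e1, e2] at h
  linarith [h, mul_comm (Real.cos (((n + 1 : ℕ) : ℝ) * x)) (Real.cos x)]

/-- `(T_n, T_{n+1})` as power-basis coefficient lists, by `T_{n+2} = 2X·T_{n+1} - T_n`. [folklore] -/
def chebPair : ℕ → List ℚ × List ℚ
  | 0 => ([1], [0, 1])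
  | n + 1 => ((chebPair n).2, padd (pmul [0, 2] (chebPair n).2) (pscale (-1) (chebPair n).1))

/-- The Chebyshev polynomial `T_n` as a power-basis coefficient list. [folklore] -/
def chebT (n : ℕ) : List ℚ := (chebPair n).1

/-- Auxiliary lemma `peval_chebPair`: `T_n(cos x) = cos(n x)`, `T_{n+1}(cos x) = cos((n+1) x)`. -/
theorem peval_chebPair (n : ℕ) (x : ℝ) :
    peval (chebPair n).1 (Real.cos x) = Real.cos ((n : ℝ) * x) ∧
      peval (chebPair n).2 (Real.cos x) = Real.cos (((n + 1 : ℕ) : ℝ) * x) := by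
  induction n with
  | zero => constructor <;> simp [chebPair]
  | succ n ih =>
    refine ⟨?_, ?_⟩
    · simpa [chebPair] using ih.2
    · have h := cos_add_two_mul_rec n x
      have e : ((n + 1 + 1 : ℕ) : ℝ) = ((n + 2 : ℕ) : ℝ) := by push_cast; ring
      simp only [chebPair, peval_padd, peval_pmul, peval_pscale, ih.1, ih.2, peval_cons, peval_nil]
      rw [e, h]
      push_cast
      ring

/-- **`T_n(cos x) = cos(n x)`**. [folklore] -/
theorem peval_chebT (n : ℕ) (x : ℝ) : peval (chebT n) (Real.cos x) = Real.cos ((n : ℝ) * x) :=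
  (peval_chebPair n x).1

/-! ### Cosine tables ↔ the power basis; table sums -/

/-- `Σ_j row[j] · T_{m₁}(x) T_{m₂+j}(y)` in the power basis. [folklore] -/
def ofCosRow (m1 : ℕ) : List ℚ → ℕ → List (List ℚ)
  | [], _ => []
  | c :: cs, m2 => padd2 (outer (pscale c (chebT m1)) (chebT m2)) (ofCosRow m1 cs (m2 + 1))

/-- A cosine table `W[i][j] ↔ Σ W[i][j] cos((m₁+i) q₀) cos(j q₁)` in the power basis of
`(cos q₀, cos q₁)`. [folklore] -/
def ofCosTable : List (List ℚ) → ℕ → List (List ℚ)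
  | [], _ => []
  | row :: rows, m1 => padd2 (ofCosRow m1 row 0) (ofCosTable rows (m1 + 1))

/-- `Σ_j row[j] · F(j₀ + j)` (structural). [folklore] -/
def rowSum : List ℚ → ℕ → (ℕ → ℝ) → ℝ
  | [], _, _ => 0
  | c :: cs, j, F => (c : ℝ) * F j + rowSum cs (j + 1) F

/-- `Σ_i Σ_j W[i][j] · F(i₀ + i, j)` (structural). [folklore] -/
def tableSum : List (List ℚ) → ℕ → (ℕ → ℕ → ℝ) → ℝ
  | [], _, _ => 0
  | row :: rows, i, F => rowSum row 0 (F i) + tableSum rows (i + 1) F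

/-- Auxiliary lemma `peval2_ofCosRow`. -/
theorem peval2_ofCosRow (m1 : ℕ) (row : List ℚ) (m2 : ℕ) (x y : ℝ) :
    peval2 (ofCosRow m1 row m2) (Real.cos x) (Real.cos y) =
      rowSum row m2 (fun j => Real.cos ((m1 : ℝ) * x) * Real.cos ((j : ℝ) * y)) := by
  induction row generalizing m2 with
  | nil => simp [ofCosRow, rowSum]
  | cons c cs ih =>
    simp only [ofCosRow, rowSum, peval2_padd2, peval2_outer, peval_pscale, peval_chebT, ih]
    ring

/-- **The power-basis image of a cosine table evaluates to its cosine series.** [folklore] -/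
theorem peval2_ofCosTable (W : List (List ℚ)) (m1 : ℕ) (x y : ℝ) :
    peval2 (ofCosTable W m1) (Real.cos x) (Real.cos y) =
      tableSum W m1 (fun i j => Real.cos ((i : ℝ) * x) * Real.cos ((j : ℝ) * y)) := by
  induction W generalizing m1 with
  | nil => simp [ofCosTable, tableSum]
  | cons row rows ih => simp only [ofCosTable, tableSum, peval2_padd2, peval2_ofCosRow, ih]

/-- The table read as a real function on `ℕ × ℕ` (zero off the table). [folklore] -/
def tableFun (W : List (List ℚ)) (p : ℕ × ℕ) : ℝ := (((W.getD p.1 []).getD p.2 0 : ℚ) : ℝ)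

/-- Auxiliary lemma `sum_range_row_getD`: a `Finset.range` sum over a row read with default `0`. -/
theorem sum_range_row_getD (row : List ℚ) (G : ℕ → ℝ) :
    ∀ (j0 M : ℕ), row.length ≤ M →
      ∑ j ∈ range M, ((row.getD j 0 : ℚ) : ℝ) * G (j0 + j) = rowSum row j0 G := by
  induction row with
  | nil => intro j0 M _; simp [rowSum]
  | cons c cs ih =>
    intro j0 M hM
    cases M with
    | zero => simp at hM
    | succ M =>
      rw [Finset.sum_range_succ']
      simp only [List.getD_cons_succ, List.getD_cons_zero, add_zero, rowSum]
      have hM' : cs.length ≤ M := by simpa using hM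
      rw [← ih (j0 + 1) M hM', add_comm]
      refine congrArg (fun z => (c : ℝ) * G j0 + z) (Finset.sum_congr rfl fun j _ => ?_)
      rw [show j0 + (j + 1) = j0 + 1 + j by omega]

/-- Auxiliary lemma `sum_range_table_getD`: a double `Finset.range` sum over a table read with default `0`. -/
theorem sum_range_table_getD (W : List (List ℚ)) (F : ℕ → ℕ → ℝ) :
    ∀ (i0 N M : ℕ), W.length ≤ N → (∀ row ∈ W, row.length ≤ M) →
      ∑ i ∈ range N, ∑ j ∈ range M, (((W.getD i []).getD j 0 : ℚ) : ℝ) * F (i0 + i) j =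
        tableSum W i0 F := by
  induction W with
  | nil => intro i0 N M _ _; simp [tableSum]
  | cons row rows ih =>
    intro i0 N M hN hrows
    cases N with
    | zero => simp at hN
    | succ N =>
      rw [Finset.sum_range_succ']
      simp only [List.getD_cons_succ, List.getD_cons_zero, add_zero, tableSum]
      have hN' : rows.length ≤ N := by simpa using hN
      have hrow : row.length ≤ M := hrows row (by simp)
      have hrows' : ∀ r ∈ rows, r.length ≤ M := fun r hr => hrows r (by simp [hr])
      rw [← ih (i0 + 1) N M hN' hrows', add_comm]
      have h0 := sum_range_row_getD row (F i0) 0 M hrow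
      simp only [zero_add] at h0
      rw [h0]
      refine congrArg (fun z => rowSum row 0 (F i0) + z)
        (Finset.sum_congr rfl fun i _ => Finset.sum_congr rfl fun j _ => ?_)
      rw [show i0 + (i + 1) = i0 + 1 + i by omega]

/-- **The dictionary kernel of a table** on the index box `range N ×ˢ range M` is its cosine series (Literature
`klsKernel_windowDict`). [folklore] -/
theorem klsKernel_table (L : ℕ) [NeZero L] (W : List (List ℚ)) (N M : ℕ) (hN : W.length ≤ N)
    (hM : ∀ row ∈ W, row.length ≤ M) (b t : ℝ) (q : TorusSite 2 L) :
    klsKernel L (windowDict L (range N ×ˢ range M) (tableFun W)) b t q =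
      tableSum W 0 (fun i j => Real.cos ((i : ℝ) * latticeMomentum L q 0) * Real.cos ((j : ℝ) * latticeMomentum L q 1)) +
        b * (torusCosSum L q / 2) + t := by
  rw [klsKernel_windowDict, Finset.sum_product]
  have h := sum_range_table_getD W
    (fun i j => Real.cos ((i : ℝ) * latticeMomentum L q 0) * Real.cos ((j : ℝ) * latticeMomentum L q 1)) 0 N M hN hM
  simp only [zero_add] at h
  simp only [tableFun] at h ⊢
  rw [h]

/-! ### Table arithmetic read through `tableFun` -/

/-- Auxiliary lemma `getD_padd`: `padd` is coefficientwise under `getD · 0`. -/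
theorem getD_padd (a b : List ℚ) (j : ℕ) : (padd a b).getD j 0 = a.getD j 0 + b.getD j 0 := by
  induction a generalizing b j with
  | nil => simp [padd]
  | cons c cs ih =>
    cases b with
    | nil => simp [padd]
    | cons d ds =>
      cases j with
      | zero => simp only [padd, List.getD_cons_zero]
      | succ n => simp only [padd, List.getD_cons_succ, ih]

/-- Auxiliary lemma `getD_pscale`: `pscale` is coefficientwise under `getD · 0`. -/
theorem getD_pscale (y : ℚ) (a : List ℚ) (j : ℕ) : (pscale y a).getD j 0 = y * a.getD j 0 := by
  induction a generalizing j with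
  | nil => simp [pscale]
  | cons c cs ih =>
    cases j with
    | zero => simp only [pscale, List.getD_cons_zero]
    | succ n => simp only [pscale, List.getD_cons_succ, ih]

/-- Auxiliary lemma `getD_padd2`: `padd2` is rowwise `padd` under `getD · []`. -/
theorem getD_padd2 (A B : List (List ℚ)) (i : ℕ) : (padd2 A B).getD i [] = padd (A.getD i []) (B.getD i []) := by
  induction A generalizing B i with
  | nil => simp [padd2, padd]
  | cons p ps ih =>
    cases B with
    | nil =>
      have e : ∀ x : List ℚ, padd x [] = x := fun x => by cases x <;> rfl
      simp [padd2, e]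
    | cons q qs =>
      cases i with
      | zero => simp only [padd2, List.getD_cons_zero]
      | succ n => simp only [padd2, List.getD_cons_succ, ih]

/-- Auxiliary lemma `getD_pscale2`: `pscale2` is rowwise `pscale` under `getD · []`. -/
theorem getD_pscale2 (y : ℚ) (A : List (List ℚ)) (i : ℕ) : (pscale2 y A).getD i [] = pscale y (A.getD i []) := by
  induction A generalizing i with
  | nil => simp [pscale2, pscale]
  | cons p ps ih =>
    cases i with
    | zero => simp only [pscale2, List.getD_cons_zero]
    | succ n => simp only [pscale2, List.getD_cons_succ, ih]

/-- **`tableFun` is additive.** [folklore] -/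
theorem tableFun_padd2 (A B : List (List ℚ)) (p : ℕ × ℕ) :
    tableFun (padd2 A B) p = tableFun A p + tableFun B p := by
  simp only [tableFun, getD_padd2, getD_padd]
  push_cast
  ring

/-- **`tableFun` is homogeneous.** [folklore] -/
theorem tableFun_pscale2 (y : ℚ) (A : List (List ℚ)) (p : ℕ × ℕ) :
    tableFun (pscale2 y A) p = (y : ℝ) * tableFun A p := by
  simp only [tableFun, getD_pscale2, getD_pscale]
  push_cast
  ring

/-- Auxiliary lemma `getD_eq_zero_of_isZero1`. -/
theorem getD_eq_zero_of_isZero1 {a : List ℚ} (h : isZero1 a = true) (j : ℕ) : a.getD j 0 = 0 := by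
  induction a generalizing j with
  | nil => simp
  | cons c cs ih =>
    simp only [isZero1, Bool.and_eq_true, decide_eq_true_eq] at h
    cases j with
    | zero => simpa only [List.getD_cons_zero] using h.1
    | succ n => simpa only [List.getD_cons_succ] using ih h.2 n

/-- Auxiliary lemma `tableFun_eq_zero_of_isZero2`. -/
theorem tableFun_eq_zero_of_isZero2 {T : List (List ℚ)} (h : isZero2 T = true) (p : ℕ × ℕ) : tableFun T p = 0 := by
  unfold tableFun
  induction T generalizing p with
  | nil => simp
  | cons r rs ih =>
    simp only [isZero2, Bool.and_eq_true] at h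
    obtain ⟨i, j⟩ := p
    cases i with
    | zero => simp only [List.getD_cons_zero, getD_eq_zero_of_isZero1 h.1 j, Rat.cast_zero]
    | succ i => simpa only [List.getD_cons_succ] using ih h.2 (i, j)

/-- **Soundness of the coefficient test for table lookup**: `equiv2 A B` implies `tableFun A = tableFun B`. [folklore] -/
theorem tableFun_eq_of_equiv2 {A B : List (List ℚ)} (h : equiv2 A B = true) (p : ℕ × ℕ) :
    tableFun A p = tableFun B p := by
  have h0 := tableFun_eq_zero_of_isZero2 h p
  rw [tableFun_padd2, tableFun_pscale2] at h0
  push_cast at h0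
  linarith

/-- **A table paired with any array of unknowns** on its index box is its structural table sum. [folklore] -/
theorem sum_tableFun_mul (W : List (List ℚ)) (N M : ℕ) (hN : W.length ≤ N) (hM : ∀ row ∈ W, row.length ≤ M)
    (F : ℕ → ℕ → ℝ) :
    ∑ p ∈ range N ×ˢ range M, tableFun W p * F p.1 p.2 = tableSum W 0 F := by
  rw [Finset.sum_product]
  have h := sum_range_table_getD W F 0 N M hN hM
  simp only [zero_add] at h
  simpa [tableFun] using h

end Summit.HubbardSuperconductivity.HubbardLadder.PolyCert
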